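import Summits.HodgeConjecture.HodgeConjecture.Theorems.Q8MonodromyBireflectionAssembly
import HarnessLib

/-!
# K1Q stub S5 (v6): the assembly with ranks from `γ ≠ 1` on `ker(A² + 1)` (variant compatible with the exceptional curves)

Sub-problem `HodgeConjecture`, route `Summits/HodgeConjecture/HodgeConjecture/Theses/Q8SymplecticPowers.lean` (crux K1Q
`VeryGeneralQuaternionCommutatorsInHg`, stmt-HodgeConjecture-24190, stub S5). Written by the prover seat `hodge-nonav-prover-Ax` (g18).
HC ∕ HC_AV ∕ K1Q are NOT proved here. Sequel of `Q8MonodromyBireflectionAssembly` (`monodromyBireflection_of_twoBallDatum`,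
`…_of_ne_one`): the d6 monodromy of the quaternionic family also permutes the exceptional curves of the member (classes in `ker(A − 1)`,
swapped `E₊ ↔ E₋`), so the non-triviality `γ ≠ 1` must be asked, and the variation inclusion `h_* y − y ∈ W₁ + W₂` can only be expected,
on the `τ² = −1` part. `monodromyBireflection_of_twoBallDatum_of_ne_one_ker` is that form.
-/

noncomputable section

set_option backward.isDefEq.respectTransparency false
set_option linter.dupNamespace false

open Module LinearMap CategoryTheory
open scoped TensorProduct
open Literature.AlgebraicTopology.SingularHomology Literature.AlgebraicGeometry Literature.AlgebraicGeometry.Motives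
open Literature.AlgebraicGeometry.HodgeTheory Literature.AlgebraicGeometry.HodgeTheory.BettiUniverse

namespace Summit.HodgeConjecture.HodgeConjecture.Theorems.Q8MonodromyBireflectionAssembly

open Summit.HodgeConjecture.HodgeConjecture.Theorems.Q8BireflectionRecognitionHomological
open Summit.HodgeConjecture.HodgeConjecture.Theorems.Q8SymplecticPowersMonodromyDeckCommutes

variable {𝒳 S : SchemeOver ℂ} (π : 𝒳 ⟶ S) {τ : 𝒳 ⟶ 𝒳} (hτπ : τ ≫ π = π)

/-! ### The rank hypotheses from `γ ≠ 1` ON `ker(A² + 1)` (the form compatible with the exceptional curves)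

The d6 monodromy also permutes the exceptional curves of the member (classes in `ker(A − 1)`), so `γ ≠ 1` must be asked, and the
variation inclusion can only be expected, on the `τ² = −1` part: this section is the corresponding variant of
`finrank_eq_two_of_variation` ∕ `monodromyBireflection_of_twoBallDatum_of_ne_one`. -/

section RankKer

variable {V : Type} [AddCommGroup V] [Module ℚ V]

/-- **Both carriers have rank `2`** from a variation that is non-trivial on `ker(t² + 1)`: `dim W₁ ≤ 2`, `t² = −1` on `W₁`, `js` injective
exchanging `W₁, W₂`, `hm y − y ∈ W₁ + W₂` for all `y` with `t² y = −y`, and `hm y₀ ≠ y₀` for one such `y₀`. [folklore] -/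
theorem finrank_eq_two_of_variation_ker [FiniteDimensional ℚ V] (W₁ W₂ : Submodule ℚ V) (t js hm : V →ₗ[ℚ] V)
    (hW₁ : finrank ℚ W₁ ≤ 2) (htW₁ : ∀ w ∈ W₁, t w ∈ W₁) (htt₁ : ∀ w ∈ W₁, t (t w) = -w) (hjs : Function.Injective js)
    (hjW₁ : ∀ w ∈ W₁, js w ∈ W₂) (hjW₂ : ∀ w ∈ W₂, js w ∈ W₁) (hvar : ∀ y, t (t y) = -y → hm y - y ∈ W₁ ⊔ W₂)
    (hne : ∃ y, t (t y) = -y ∧ hm y ≠ y) : finrank ℚ W₁ = 2 ∧ finrank ℚ W₂ = 2 := by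
  have h12 : finrank ℚ W₁ = finrank ℚ W₂ :=
    le_antisymm (finrank_le_of_mapsTo_of_injective W₁ W₂ js hjs hjW₁) (finrank_le_of_mapsTo_of_injective W₂ W₁ js hjs hjW₂)
  obtain ⟨y₀, hy₀, hy₀'⟩ := hne
  have hsup : W₁ ⊔ W₂ ≠ ⊥ := by
    intro hbot
    apply hy₀'
    have hy := hvar y₀ hy₀
    rw [hbot, Submodule.mem_bot, sub_eq_zero] at hy
    exact hy
  have hW₁ne : W₁ ≠ ⊥ := by
    intro h1
    have h2 : W₂ = ⊥ := Submodule.finrank_eq_zero.mp (by rw [← h12, h1, finrank_bot])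
    exact hsup (by rw [h1, h2, bot_sup_eq])
  have h1 : finrank ℚ W₁ = 2 := finrank_eq_two_of_le_two W₁ hW₁ (even_finrank_of_sq_eq_neg_one W₁ t htW₁ htt₁) hW₁ne
  exact ⟨h1, h12 ▸ h1⟩

end RankKer

/-- **K1Q stub S5 (v6) at a point `s` — ranks from `γ ≠ 1` on `ker(A² + 1)`.** As `monodromyBireflection_of_twoBallDatum`, with `dim W₁ ≤ 2`,
the variation inclusion on `ker(τ_*² + 1)` only, and `γ a₀ ≠ a₀` for one `a₀ ∈ ker(A² + 1)` in place of `dim W₁ = dim W₂ = 2` (the d6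
monodromy may act non-trivially on `ker(A − 1)`, permuting exceptional curves, without contributing to the carriers).
[cite: VoisinHodgeII2003, §3.1.2 and §3.2.1] [cite: HatcherAT2002, §3.3 Thm. 3.30 and Prop. 3.38] -/
theorem monodromyBireflection_of_twoBallDatum_of_ne_one_ker (hπ : IsSmoothProjectiveFamily π 2) (h𝒳 : IsQuasiProjectiveOver 𝒳)
    (hS : IsQuasiProjectiveOver S) {j : 𝒳 ⟶ 𝒳} (hjπ : j ≫ π = π) (h4 : τ ≫ τ ≫ τ ≫ τ = 𝟙 𝒳) (hjj : j ≫ j = τ ≫ τ)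
    (hτjτ : τ ≫ j ≫ τ = j) (hU : IsCohomologicallyLocallyTrivialOn π (Set.univ : Set (ComplexPoints S))) (s : ComplexPoints S)
    (γ : bettiCohomology (fiberOver π s) 2 ≃ₗ[ℚ] bettiCohomology (fiberOver π s) 2)
    (hγΓ : γ ∈ ratMonodromyGroup π 2 hU ⟨s, Set.mem_univ s⟩)
    (hγ1 : ∃ a, pull (fiberOverEnd π τ hτπ s) 2 (pull (fiberOverEnd π τ hτπ s) 2 a) = -a ∧ γ a ≠ a)
    (h : ComplexPoints (fiberOver π s) ≃ₜ ComplexPoints (fiberOver π s))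
    (hγh : ∀ a, γ a = (singularCohomology.map ℚ ℚ (h : C(ComplexPoints (fiberOver π s), ComplexPoints (fiberOver π s))) 2).hom a)
    (hhμ : singularHomology.map ℚ ℚ (h : C(ComplexPoints (fiberOver π s), ComplexPoints (fiberOver π s))) 4
      (complexOrientationRat (hπ.isSmoothProjective s)).fundamentalClass = (complexOrientationRat (hπ.isSmoothProjective s)).fundamentalClass)
    (hPD : Function.Bijective (poincareDualityMap (n := 4) (complexOrientationRat (hπ.isSmoothProjective s)) (show 2 + 2 = 4 by norm_num)))
    (W₁ W₂ : Submodule ℚ (singularHomology ℚ ℚ (ComplexPoints (fiberOver π s)) 2)) (hW₁ : finrank ℚ W₁ ≤ 2)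
    (htW₁ : ∀ w ∈ W₁, singularHomology.map ℚ ℚ (AlgPoints.mapContinuous (L := ℂ) (fiberOverEnd π τ hτπ s)) 2 w ∈ W₁)
    (htW₂ : ∀ w ∈ W₂, singularHomology.map ℚ ℚ (AlgPoints.mapContinuous (L := ℂ) (fiberOverEnd π τ hτπ s)) 2 w ∈ W₂)
    (htt₁ : ∀ w ∈ W₁, singularHomology.map ℚ ℚ (AlgPoints.mapContinuous (L := ℂ) (fiberOverEnd π τ hτπ s)) 2
      (singularHomology.map ℚ ℚ (AlgPoints.mapContinuous (L := ℂ) (fiberOverEnd π τ hτπ s)) 2 w) = -w)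
    (htt₂ : ∀ w ∈ W₂, singularHomology.map ℚ ℚ (AlgPoints.mapContinuous (L := ℂ) (fiberOverEnd π τ hτπ s)) 2
      (singularHomology.map ℚ ℚ (AlgPoints.mapContinuous (L := ℂ) (fiberOverEnd π τ hτπ s)) 2 w) = -w)
    (hjW₁ : ∀ w ∈ W₁, singularHomology.map ℚ ℚ (AlgPoints.mapContinuous (L := ℂ) (fiberOverEnd π j hjπ s)) 2 w ∈ W₂)
    (hjW₂ : ∀ w ∈ W₂, singularHomology.map ℚ ℚ (AlgPoints.mapContinuous (L := ℂ) (fiberOverEnd π j hjπ s)) 2 w ∈ W₁)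
    (hvar : ∀ y, singularHomology.map ℚ ℚ (AlgPoints.mapContinuous (L := ℂ) (fiberOverEnd π τ hτπ s)) 2
      (singularHomology.map ℚ ℚ (AlgPoints.mapContinuous (L := ℂ) (fiberOverEnd π τ hτπ s)) 2 y) = -y →
      singularHomology.map ℚ ℚ (h : C(ComplexPoints (fiberOver π s), ComplexPoints (fiberOver π s))) 2 y - y ∈ W₁ ⊔ W₂)
    (hh₁ : ∀ w ∈ W₁, singularHomology.map ℚ ℚ (h : C(ComplexPoints (fiberOver π s), ComplexPoints (fiberOver π s))) 2 w =
      singularHomology.map ℚ ℚ (AlgPoints.mapContinuous (L := ℂ) (fiberOverEnd π τ hτπ s)) 2 w)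
    (hh₂ : ∀ w ∈ W₂, singularHomology.map ℚ ℚ (h : C(ComplexPoints (fiberOver π s), ComplexPoints (fiberOver π s))) 2
      (singularHomology.map ℚ ℚ (AlgPoints.mapContinuous (L := ℂ) (fiberOverEnd π τ hτπ s)) 2 w) = w)
    (horth : ∀ a b, poincareDualityMap (n := 4) (complexOrientationRat (hπ.isSmoothProjective s)) (show 2 + 2 = 4 by norm_num) a ∈ W₁ →
      poincareDualityMap (n := 4) (complexOrientationRat (hπ.isSmoothProjective s)) (show 2 + 2 = 4 by norm_num) b ∈ W₂ →
      tr (hπ.isSmoothProjective s) (2 + 2) (cup (fiberOver π s) 2 2 a b) = 0) :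
    let Xs := fiberOver π s
    let hXs : IsSmoothProjective 2 Xs := hπ.isSmoothProjective s
    let A : bettiCohomology Xs 2 →ₗ[ℚ] bettiCohomology Xs 2 := pull (fiberOverEnd π τ hτπ s) 2
    let B : bettiCohomology Xs 2 →ₗ[ℚ] bettiCohomology Xs 2 := pull (fiberOverEnd π j hjπ s) 2
    let Qf : LinearMap.BilinForm ℚ (bettiCohomology Xs 2) := LinearMap.compr₂ (cup Xs 2 2) (tr hXs (2 + 2))
    let Γ := ratMonodromyGroup π 2 hU ⟨s, Set.mem_univ s⟩
    ∃ γ ∈ Γ, ∃ ℓp ℓm : TensorProduct ℚ ℂ (bettiCohomology Xs 2),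
      ℓp ∈ (Module.End.eigenspace (A ^ 2) (-1)).baseChange ℂ ∧ ℓm ∈ (Module.End.eigenspace (A ^ 2) (-1)).baseChange ℂ ∧
      A.baseChange ℂ ℓp = Complex.I • ℓp ∧ A.baseChange ℂ ℓm = Complex.I • ℓm ∧ (Qf.baseChange ℂ) ℓp (B.baseChange ℂ ℓm) ≠ 0 ∧
      (γ.toLinearMap.baseChange ℂ) ℓp = Complex.I • ℓp ∧ (γ.toLinearMap.baseChange ℂ) ℓm = (-Complex.I) • ℓm ∧
      ∀ x ∈ (Module.End.eigenspace (A ^ 2) (-1)).baseChange ℂ, A.baseChange ℂ x = Complex.I • x →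
        (Qf.baseChange ℂ) x (B.baseChange ℂ ℓp) = 0 → (Qf.baseChange ℂ) x (B.baseChange ℂ ℓm) = 0 → (γ.toLinearMap.baseChange ℂ) x = x := by
  intro Xs hXs A B Qf Γ
  haveI : Module.Finite ℚ (bettiCohomology Xs 2) := BettiUniverse.finite hXs 2
  haveI : Module.Finite ℚ (singularHomology ℚ ℚ (ComplexPoints Xs) 2) :=
    Module.Finite.of_surjective (poincareDualityMap (n := 4) (complexOrientationRat hXs) (show 2 + 2 = 4 by norm_num)) hPD.2
  -- `j_s(ℂ)_*` is injective (induced by a homeomorphism)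
  let ej : Xs ≅ Xs := ⟨fiberOverEnd π j hjπ s, fiberOverEnd π (j ≫ j ≫ j) (by rw [Category.assoc, Category.assoc, hjπ, hjπ, hjπ]) s,
    fiberOverEnd_comp_cube_eq_id π hjπ (comp_four_eq_id_of_sq h4 hjj) s,
    fiberOverEnd_cube_comp_eq_id π hjπ (comp_four_eq_id_of_sq h4 hjj) s⟩
  let jh : ComplexPoints Xs ≃ₜ ComplexPoints Xs := HodgeTheory.AlgPoints.homeomorphOfIso ej
  have hjinj : Function.Injective (singularHomology.map ℚ ℚ (AlgPoints.mapContinuous (L := ℂ) (fiberOverEnd π j hjπ s)) 2).hom := by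
    change Function.Injective (singularHomology.mapIso ℚ ℚ jh 2).toLinearEquiv
    exact (singularHomology.mapIso ℚ ℚ jh 2).toLinearEquiv.injective
  -- the duality square of `τ_s`: `t (D (A a)) = D a`, hence `D` carries `ker(A² + 1)` into `ker(t² + 1)`
  let eτ : Xs ≅ Xs := ⟨fiberOverEnd π τ hτπ s, fiberOverEnd π (τ ≫ τ ≫ τ) (by rw [Category.assoc, Category.assoc, hτπ, hτπ, hτπ]) s,
    fiberOverEnd_comp_cube_eq_id π hτπ h4 s, fiberOverEnd_cube_comp_eq_id π hτπ h4 s⟩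
  let τh : ComplexPoints Xs ≃ₜ ComplexPoints Xs := HodgeTheory.AlgPoints.homeomorphOfIso eτ
  have hτμ : singularHomology.map ℚ ℚ (τh : C(ComplexPoints Xs, ComplexPoints Xs)) 4 (complexOrientationRat hXs).fundamentalClass =
      (complexOrientationRat hXs).fundamentalClass := map_fundamentalClass_complexOrientationRat_of_iso hXs hXs eτ
  have hDA : ∀ a, singularHomology.map ℚ ℚ (AlgPoints.mapContinuous (L := ℂ) (fiberOverEnd π τ hτπ s)) 2
      (poincareDualityMap (n := 4) (complexOrientationRat hXs) (show 2 + 2 = 4 by norm_num) (A a)) =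
      poincareDualityMap (n := 4) (complexOrientationRat hXs) (show 2 + 2 = 4 by norm_num) a := fun a =>
    map_poincareDualityMap_map (complexOrientationRat hXs) _ (τh : C(ComplexPoints Xs, ComplexPoints Xs)) hτμ a
  -- `h_* ≠ 1` on `ker(t² + 1)` from `γ a₀ ≠ a₀`, `A² a₀ = −a₀`
  have hne : ∃ y, singularHomology.map ℚ ℚ (AlgPoints.mapContinuous (L := ℂ) (fiberOverEnd π τ hτπ s)) 2
      (singularHomology.map ℚ ℚ (AlgPoints.mapContinuous (L := ℂ) (fiberOverEnd π τ hτπ s)) 2 y) = -y ∧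
      singularHomology.map ℚ ℚ (h : C(ComplexPoints Xs, ComplexPoints Xs)) 2 y ≠ y := by
    obtain ⟨a₀, ha₀, hγa₀⟩ := hγ1
    refine ⟨poincareDualityMap (n := 4) (complexOrientationRat hXs) (show 2 + 2 = 4 by norm_num) (γ a₀), ?_, ?_⟩
    · -- `γ a₀ ∈ ker(A² + 1)` (`γ` commutes with `A`), and `D` maps `ker(A² + 1)` into `ker(t² + 1)`
      have hγA : ∀ x, γ (A x) = A (γ x) := fun x => apply_pull_fiberOverEnd_of_mem_ratMonodromyGroup π 2 hU τ hτπ s hγΓ x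
      have h1 : A (A (γ a₀)) = -(γ a₀) := by rw [← hγA, ← hγA, ha₀, map_neg]
      -- `t (D (A x)) = D x` twice: `t (t (D (A (A x)))) = D x`; with `A (A x) = -x`
      have h3 : singularHomology.map ℚ ℚ (AlgPoints.mapContinuous (L := ℂ) (fiberOverEnd π τ hτπ s)) 2
          (singularHomology.map ℚ ℚ (AlgPoints.mapContinuous (L := ℂ) (fiberOverEnd π τ hτπ s)) 2
            (poincareDualityMap (n := 4) (complexOrientationRat hXs) (show 2 + 2 = 4 by norm_num) (A (A (γ a₀))))) =
          poincareDualityMap (n := 4) (complexOrientationRat hXs) (show 2 + 2 = 4 by norm_num) (γ a₀) := by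
        rw [hDA, hDA]
      rw [h1, map_neg, map_neg, map_neg, neg_eq_iff_eq_neg] at h3
      exact h3
    · intro hfix
      apply hγa₀
      have hsq := map_poincareDualityMap_map (complexOrientationRat hXs) (show 2 + 2 = 4 by norm_num)
        (h : C(ComplexPoints Xs, ComplexPoints Xs)) hhμ (γ a₀)
      rw [← hγh] at hsq
      -- `hsq : h_* (D (γ (γ a₀))) = D (γ a₀)`; we need `γ a₀ = a₀`: use the square at `a₀` instead
      have hsq' := map_poincareDualityMap_map (complexOrientationRat hXs) (show 2 + 2 = 4 by norm_num)
        (h : C(ComplexPoints Xs, ComplexPoints Xs)) hhμ a₀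
      rw [← hγh, hfix] at hsq'
      exact hPD.1 hsq'
  obtain ⟨hW₁', hW₂'⟩ := finrank_eq_two_of_variation_ker W₁ W₂
    (singularHomology.map ℚ ℚ (AlgPoints.mapContinuous (L := ℂ) (fiberOverEnd π τ hτπ s)) 2).hom
    (singularHomology.map ℚ ℚ (AlgPoints.mapContinuous (L := ℂ) (fiberOverEnd π j hjπ s)) 2).hom
    (singularHomology.map ℚ ℚ (h : C(ComplexPoints Xs, ComplexPoints Xs)) 2).hom hW₁ htW₁ htt₁ hjinj hjW₁ hjW₂ hvar hne
  exact monodromyBireflection_of_twoBallDatum π hτπ hπ h𝒳 hS hjπ h4 hjj hτjτ hU s γ hγΓ h hγh hhμ hPD W₁ W₂ hW₁' hW₂' htW₁ htW₂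
    htt₁ htt₂ hjW₁ hjW₂ hvar hh₁ hh₂ horth


end Summit.HodgeConjecture.HodgeConjecture.Theorems.Q8MonodromyBireflectionAssembly

end
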